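import Summits.Ventures.PercRepro.RankLevelSetLevelSixHeavyCellSq27DI2V
import Summits.Ventures.PercRepro.RankLevelSetCoreSixColoopFreeUnion
import Summits.Ventures.PercRepro.RankLevelSetLevelSixCapGlue25
import Summits.Ventures.PercRepro.TriangleCapEightI
import Summits.Ventures.PercRepro.S1TrianglePlusSharp
import Summits.Ventures.PercRepro.S1SeriesLever14
import Summits.Ventures.PercRepro.RankLevelSetCircuitUnionRank
import Summits.Ventures.PercRepro.RankLevelSetLevelSixArithHeavySq23TN19_23TZ8A
import Summits.Ventures.PercRepro.RankLevelSetLevelSixArithHeavySq22TF8_21TF8A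

/-!
# PercRepro — THE 23 ROW, CORANK 8, PART A: THE HONEST COLOOP-FREE CELL WITHOUT A 12-POINT RANK-5 SET (UH = ∅) AND THE SCALED CELLS AT LEVELS 1, 2 (p8 g11, S3)

`proofs/SUBCLAIM-S3-p8.md` §3y. `(phiK p 6)·#U ≤ #Y` on a coloop-free `e`-free core of rank `p ≥ 23`, corank `8`, on the cell `sq27di2v` with the `H`-term factor `p + 8 − 0` (`ν₁ = 7`, `j = 2`, `j′ = 1`, `|UG| ≤ 13`, `|UH| ≤ 0`, `Kn/Kd = 92052/1000`; `D = C(p + 6, 6)`; caps `s₃ ≤ 11`, `s₄ ≤ 62`, `s₅ ≤ 429`, `s₆ ≤ 1145`, `s₇ ≤ 2216` at `n₀ = 31`, `s₃` by THE TRIANGLE DROP `ncard_triangles_le_cq3_pred_of_coloopFree`; parts RankLevelSetLevelSixArithHeavySq23TZ8A). Axioms: standard.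

`proofs/SUBCLAIM-S3-p8.md` §3y. `(phiK (p + 1) 6 / 2)·#U ≤ #Y` on a coloop-free `e`-free core of rank `p ≥ 22`, corank `8`, on the cell `sq27di2v` with the `H`-term factor `p + 8 − 12` (`ν₁ = 7`, `j = 2`, `j′ = 1`, `|UG| ≤ 13`, `|UH| ≤ 12`, `Kn/Kd = 55050/1000`; `D = C(p + 7, 6)`; caps `s₃ ≤ 11`, `s₄ ≤ 62`, `s₅ ≤ 432`, `s₆ ≤ 1155`, `s₇ ≤ 2238` at `n₀ = 30`, `s₃` by THE TRIANGLE DROP `ncard_triangles_le_cq3_pred_of_coloopFree`; parts RankLevelSetLevelSixArithHeavySq22TF8A). Axioms: standard.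

`proofs/SUBCLAIM-S3-p8.md` §3y. `(phiK (p + 2) 6 / 4)·#U ≤ #Y` on a coloop-free `e`-free core of rank `p ≥ 21`, corank `8`, on the cell `sq27di2v` with the `H`-term factor `p + 8 − 12` (`ν₁ = 7`, `j = 2`, `j′ = 1`, `|UG| ≤ 13`, `|UH| ≤ 12`, `Kn/Kd = 32895/1000`; `D = C(p + 8, 6)`; caps `s₃ ≤ 11`, `s₄ ≤ 62`, `s₅ ≤ 435`, `s₆ ≤ 1165`, `s₇ ≤ 2262` at `n₀ = 29`, `s₃` by THE TRIANGLE DROP `ncard_triangles_le_cq3_pred_of_coloopFree`; parts RankLevelSetLevelSixArithHeavySq21TF8A). Axioms: standard.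
-/

open scoped Matroid

namespace PercRepro

namespace ThmN

open Set

variable {α : Type}

-- ===== RankLevelSetLevelSixT23Free8 =====


/-- **THE HONEST COLOOP-FREE CELL `(p ≥ 23, 8)` WITHOUT A 12-POINT RANK-5 SET (UH = ∅) of the `23` row at corank `8`** (level 0, `phiK p 6`, `D = C(p + 6, 6)`). -/
theorem c025_core_six_t23_free8_small (M : Matroid α) [M.Finite] (p : ℕ) (hp : 23 ≤ p) (hcf : ∀ e ∈ M.E, ¬ M.IsColoop e)
    (hsmall : ∀ X ⊆ M.E, M.eRk X ≤ 5 → X.ncard ≤ 11)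
    (hR : M.eRank = (p : ℕ∞)) (hn : M.E.ncard = p + 8)
    (hfree : ∀ e ∈ M.E, ∃ A ⊆ M.E \ {e}, e ∉ M.closure A ∧ e ∉ M.closure ((M.E \ {e}) \ A)) :
    RLS M p 6 := by
  classical
  have hd : M.E.encard = M.eRank + (8 : ℕ) := by
    rw [hR, ← M.ground_finite.cast_ncard_eq, hn]
    push_cast
    ring
  have hL : ∀ e ∈ M.E, ¬ M.IsLoop e := not_isLoop_of_free M hfree
  have hs : ∀ e ∈ M.E, ∀ f ∈ M.E, e ≠ f → M.eRk {e, f} = 2 := by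
    intro e he f hf hef
    have h2 : (2 : ℕ∞) ≤ M.eRk {e, f} :=
      two_le_eRk_of_two_le_ncard_of_free M hfree (pair_subset he hf) (by rw [ncard_pair hef])
    have h3 : M.eRk {e, f} ≤ 2 := by
      have := M.eRk_le_encard {e, f}
      rwa [encard_pair hef] at this
    exact le_antisymm h3 h2
  have hc : ∀ X ⊆ M.E, M.eRk X ≤ ((6 - 2 : ℕ) : ℕ∞) → (X.ncard : ℕ∞) ≤ M.eRk X + cnull 4 :=
    fun X hX hr => nullity_cap_core M hfree 4 (le_refl 4) X hX (by simpa using hr)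
  have hc6 : cnull 4 + 1 ≤ 7 := by simp [cnull]
  have hcj : ∀ X ⊆ M.E, M.eRk X ≤ ((6 - 2 - 1 : ℕ) : ℕ∞) → (X.ncard : ℕ∞) ≤ M.eRk X + cnull (3) :=
    fun X hX hr => nullity_cap_core M hfree 3 (by omega) X hX
      (by rwa [show (6 - 2 - 1 : ℕ) = 3 by omega] at hr)
  have hcj' : ∀ X ⊆ M.E, M.eRk X ≤ ((6 - 1 - 1 - 1 : ℕ) : ℕ∞) → (X.ncard : ℕ∞) ≤ M.eRk X + cnull (3) :=
    fun X hX hr => nullity_cap_core M hfree 3 (by omega) X hX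
      (by rwa [show (6 - 1 - 1 - 1 : ℕ) = 3 by omega] at hr)
  have hUG : (Matroid.UG M 6 7).ncard ≤ 13 := by
    have := Matroid.ncard_UG_le_cf (M := M) (q := 6) (ν₁ := 7) (j := 2) (by norm_num) hcf hR hn (by omega) hc hc6 hcj (by norm_num [cnull])
    simpa using this
  have hflat5 : ∀ X ⊆ M.E, M.eRk X ≤ ((6 - 1 : ℕ) : ℕ∞) → X.ncard ≤ 11 :=
    fun X hX hr => hsmall X hX (by simpa using hr)
  have hUH : (Matroid.UH M 6 7).ncard ≤ 0 := by
    rw [Matroid.UH_eq_empty (M := M) (q := 6) (ν₁ := 7) hflat5 (by norm_num)]; simp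
  have hΦ : phiK p 6 ≤ (2 : ℚ) ^ (p + 6) / (((p + 6).choose 6 : ℕ) : ℚ) := phiK_le_two_pow_div_six p
  rw [RLS_iff]
  exact c025_core_six_heavy_cell_sq27di2v M p 8 7 13 0 0 92052 1000 14 429 62 11 1145 2216
      ((p + 6).choose 6) (Nat.choose_pos (by omega)) (phiK p 6) hΦ (by norm_num) (by omega)
      (by norm_num) hUG hUH (by omega) (Or.inl (by norm_num)) (by norm_num) (by norm_num) (by norm_num)
      ((ncard_triangles_le_cq3_pred_of_coloopFree M hfree hcf hR hn (by omega) (by omega) (by omega)).trans (by decide))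
      ((S1.ncard_fourCircuits_le_gb14 8 M hfree hd 31 (by rw [coloops_eq_empty_of_forall M hcf, Set.sdiff_empty, hn]; omega)).trans (by decide))
      (s5_cf_of M hfree hcf (d := 7) (by rw [hd]; norm_num) 31 360 429 (by norm_num) (by omega) (by decide) (by omega))
      (s6_cf_of M hfree hcf (d := 7) (by rw [hd]; norm_num) 31 924 1145 (by norm_num) (by omega) (by decide) (by omega))
      (s7_cf_of M hfree hcf (d := 7) (by rw [hd]; norm_num) 31 1716 2216 (by norm_num) (by omega) (by decide) (by omega))
      (Or.inl (tail_six_heavy_sq23TZ8_8 p hp)) hR hn hfree (level_six_poly_heavy_sq23TZ8_8 p hp)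

-- ===== RankLevelSetLevelSixT23S1Cf8 =====


/-- **THE 1-TIMES SCALED COLOOP-FREE CELL `(p ≥ 22, 8)` of the `23` row at corank `8`** (level 1, `phiK (p + 1) 6 / 2`, `D = C(p + 7, 6)`). -/
theorem c025_core_six_t23_scaled1_cf8 (M : Matroid α) [M.Finite] (p : ℕ) (hp : 22 ≤ p) (hcf : ∀ e ∈ M.E, ¬ M.IsColoop e)
    (hR : M.eRank = (p : ℕ∞)) (hn : M.E.ncard = p + 8)
    (hfree : ∀ e ∈ M.E, ∃ A ⊆ M.E \ {e}, e ∉ M.closure A ∧ e ∉ M.closure ((M.E \ {e}) \ A)) :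
    phiK (p + 1) 6 / 2 * (Matroid.topCount M p 6 : ℚ) ≤ (Matroid.midCount M p 6 : ℚ) := by
  classical
  have hd : M.E.encard = M.eRank + (8 : ℕ) := by
    rw [hR, ← M.ground_finite.cast_ncard_eq, hn]
    push_cast
    ring
  have hL : ∀ e ∈ M.E, ¬ M.IsLoop e := not_isLoop_of_free M hfree
  have hs : ∀ e ∈ M.E, ∀ f ∈ M.E, e ≠ f → M.eRk {e, f} = 2 := by
    intro e he f hf hef
    have h2 : (2 : ℕ∞) ≤ M.eRk {e, f} :=
      two_le_eRk_of_two_le_ncard_of_free M hfree (pair_subset he hf) (by rw [ncard_pair hef])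
    have h3 : M.eRk {e, f} ≤ 2 := by
      have := M.eRk_le_encard {e, f}
      rwa [encard_pair hef] at this
    exact le_antisymm h3 h2
  have hc : ∀ X ⊆ M.E, M.eRk X ≤ ((6 - 2 : ℕ) : ℕ∞) → (X.ncard : ℕ∞) ≤ M.eRk X + cnull 4 :=
    fun X hX hr => nullity_cap_core M hfree 4 (le_refl 4) X hX (by simpa using hr)
  have hc6 : cnull 4 + 1 ≤ 7 := by simp [cnull]
  have hcj : ∀ X ⊆ M.E, M.eRk X ≤ ((6 - 2 - 1 : ℕ) : ℕ∞) → (X.ncard : ℕ∞) ≤ M.eRk X + cnull (3) :=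
    fun X hX hr => nullity_cap_core M hfree 3 (by omega) X hX
      (by rwa [show (6 - 2 - 1 : ℕ) = 3 by omega] at hr)
  have hcj' : ∀ X ⊆ M.E, M.eRk X ≤ ((6 - 1 - 1 - 1 : ℕ) : ℕ∞) → (X.ncard : ℕ∞) ≤ M.eRk X + cnull (3) :=
    fun X hX hr => nullity_cap_core M hfree 3 (by omega) X hX
      (by rwa [show (6 - 1 - 1 - 1 : ℕ) = 3 by omega] at hr)
  have hUG : (Matroid.UG M 6 7).ncard ≤ 13 := by
    have := Matroid.ncard_UG_le_cf (M := M) (q := 6) (ν₁ := 7) (j := 2) (by norm_num) hcf hR hn (by omega) hc hc6 hcj (by norm_num [cnull])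
    simpa using this
  have hUH : (Matroid.UH M 6 7).ncard ≤ 12 := by
    have := Matroid.ncard_UH_le_cf (M := M) (q := 6) (ν₁ := 7) (j' := 1) (by norm_num) hcf hR hn (by omega) hc hc6 hcj' (by norm_num [cnull])
    simpa using this
  have hΦ : phiK (p + 1) 6 / 2 ≤ (2 : ℚ) ^ (p + 6) / (((p + 7).choose 6 : ℕ) : ℚ) := by
    have := phiK_succ_div_two_le p 6
    rwa [show p + 1 + 6 = p + 7 by omega] at this
  exact c025_core_six_heavy_cell_sq27di2v M p 8 7 13 12 0 55050 1000 14 432 62 11 1155 2238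
      ((p + 7).choose 6) (Nat.choose_pos (by omega)) (phiK (p + 1) 6 / 2) hΦ (by norm_num) (by omega)
      (by norm_num) hUG hUH (by omega) (Or.inl (by norm_num)) (by norm_num) (by norm_num) (by norm_num)
      ((ncard_triangles_le_cq3_pred_of_coloopFree M hfree hcf hR hn (by omega) (by omega) (by omega)).trans (by decide))
      ((S1.ncard_fourCircuits_le_gb14 8 M hfree hd 30 (by rw [coloops_eq_empty_of_forall M hcf, Set.sdiff_empty, hn]; omega)).trans (by decide))
      (s5_cf_of M hfree hcf (d := 7) (by rw [hd]; norm_num) 30 360 432 (by norm_num) (by omega) (by decide) (by omega))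
      (s6_cf_of M hfree hcf (d := 7) (by rw [hd]; norm_num) 30 924 1155 (by norm_num) (by omega) (by decide) (by omega))
      (s7_cf_of M hfree hcf (d := 7) (by rw [hd]; norm_num) 30 1716 2238 (by norm_num) (by omega) (by decide) (by omega))
      (Or.inl (tail_six_heavy_sq22TF8_8 p hp)) hR hn hfree (level_six_poly_heavy_sq22TF8_8 p hp)

-- ===== RankLevelSetLevelSixT23S2Cf8 =====


/-- **THE 2-TIMES SCALED COLOOP-FREE CELL `(p ≥ 21, 8)` of the `23` row at corank `8`** (level 2, `phiK (p + 2) 6 / 4`, `D = C(p + 8, 6)`). -/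
theorem c025_core_six_t23_scaled2_cf8 (M : Matroid α) [M.Finite] (p : ℕ) (hp : 21 ≤ p) (hcf : ∀ e ∈ M.E, ¬ M.IsColoop e)
    (hR : M.eRank = (p : ℕ∞)) (hn : M.E.ncard = p + 8)
    (hfree : ∀ e ∈ M.E, ∃ A ⊆ M.E \ {e}, e ∉ M.closure A ∧ e ∉ M.closure ((M.E \ {e}) \ A)) :
    phiK (p + 2) 6 / 4 * (Matroid.topCount M p 6 : ℚ) ≤ (Matroid.midCount M p 6 : ℚ) := by
  classical
  have hd : M.E.encard = M.eRank + (8 : ℕ) := by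
    rw [hR, ← M.ground_finite.cast_ncard_eq, hn]
    push_cast
    ring
  have hL : ∀ e ∈ M.E, ¬ M.IsLoop e := not_isLoop_of_free M hfree
  have hs : ∀ e ∈ M.E, ∀ f ∈ M.E, e ≠ f → M.eRk {e, f} = 2 := by
    intro e he f hf hef
    have h2 : (2 : ℕ∞) ≤ M.eRk {e, f} :=
      two_le_eRk_of_two_le_ncard_of_free M hfree (pair_subset he hf) (by rw [ncard_pair hef])
    have h3 : M.eRk {e, f} ≤ 2 := by
      have := M.eRk_le_encard {e, f}
      rwa [encard_pair hef] at this
    exact le_antisymm h3 h2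
  have hc : ∀ X ⊆ M.E, M.eRk X ≤ ((6 - 2 : ℕ) : ℕ∞) → (X.ncard : ℕ∞) ≤ M.eRk X + cnull 4 :=
    fun X hX hr => nullity_cap_core M hfree 4 (le_refl 4) X hX (by simpa using hr)
  have hc6 : cnull 4 + 1 ≤ 7 := by simp [cnull]
  have hcj : ∀ X ⊆ M.E, M.eRk X ≤ ((6 - 2 - 1 : ℕ) : ℕ∞) → (X.ncard : ℕ∞) ≤ M.eRk X + cnull (3) :=
    fun X hX hr => nullity_cap_core M hfree 3 (by omega) X hX
      (by rwa [show (6 - 2 - 1 : ℕ) = 3 by omega] at hr)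
  have hcj' : ∀ X ⊆ M.E, M.eRk X ≤ ((6 - 1 - 1 - 1 : ℕ) : ℕ∞) → (X.ncard : ℕ∞) ≤ M.eRk X + cnull (3) :=
    fun X hX hr => nullity_cap_core M hfree 3 (by omega) X hX
      (by rwa [show (6 - 1 - 1 - 1 : ℕ) = 3 by omega] at hr)
  have hUG : (Matroid.UG M 6 7).ncard ≤ 13 := by
    have := Matroid.ncard_UG_le_cf (M := M) (q := 6) (ν₁ := 7) (j := 2) (by norm_num) hcf hR hn (by omega) hc hc6 hcj (by norm_num [cnull])
    simpa using this
  have hUH : (Matroid.UH M 6 7).ncard ≤ 12 := by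
    have := Matroid.ncard_UH_le_cf (M := M) (q := 6) (ν₁ := 7) (j' := 1) (by norm_num) hcf hR hn (by omega) hc hc6 hcj' (by norm_num [cnull])
    simpa using this
  have hΦ : phiK (p + 2) 6 / 4 ≤ (2 : ℚ) ^ (p + 6) / (((p + 8).choose 6 : ℕ) : ℚ) := by
    have h := phiK_le_two_pow_div_six (p + 2)
    rw [show p + 2 + 6 = p + 8 by omega] at h
    have h8 : (2 : ℚ) ^ (p + 8) = 2 ^ (p + 6) * 4 := by rw [show p + 8 = p + 6 + 2 by omega, pow_add]; norm_num
    rw [h8] at h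
    calc phiK (p + 2) 6 / 4 ≤ (2 : ℚ) ^ (p + 6) * 4 / (((p + 8).choose 6 : ℕ) : ℚ) / 4 := by gcongr
      _ = (2 : ℚ) ^ (p + 6) / (((p + 8).choose 6 : ℕ) : ℚ) := by ring
  exact c025_core_six_heavy_cell_sq27di2v M p 8 7 13 12 0 32895 1000 14 435 62 11 1165 2262
      ((p + 8).choose 6) (Nat.choose_pos (by omega)) (phiK (p + 2) 6 / 4) hΦ (by norm_num) (by omega)
      (by norm_num) hUG hUH (by omega) (Or.inl (by norm_num)) (by norm_num) (by norm_num) (by norm_num)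
      ((ncard_triangles_le_cq3_pred_of_coloopFree M hfree hcf hR hn (by omega) (by omega) (by omega)).trans (by decide))
      ((S1.ncard_fourCircuits_le_gb14 8 M hfree hd 29 (by rw [coloops_eq_empty_of_forall M hcf, Set.sdiff_empty, hn]; omega)).trans (by decide))
      (s5_cf_of M hfree hcf (d := 7) (by rw [hd]; norm_num) 29 360 435 (by norm_num) (by omega) (by decide) (by omega))
      (s6_cf_of M hfree hcf (d := 7) (by rw [hd]; norm_num) 29 924 1165 (by norm_num) (by omega) (by decide) (by omega))
      (s7_cf_of M hfree hcf (d := 7) (by rw [hd]; norm_num) 29 1716 2262 (by norm_num) (by omega) (by decide) (by omega))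
      (Or.inl (tail_six_heavy_sq21TF8_8 p hp)) hR hn hfree (level_six_poly_heavy_sq21TF8_8 p hp)

end ThmN

end PercRepro
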